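import Literature.AlgebraicGeometry.Motives.HilbertImageInGrassmannianUniversalFamily
import Literature.AlgebraicGeometry.Modules.ProjectiveFamilyTwistPushforward
import Mathlib.AlgebraicGeometry.Noetherian
import HarnessLib

/-!
# The piece of the Hom scheme cut out by one Hilbert polynomial: the data `(M_Q, c, u_Q)`, SELF, GRAPH-ID

Layer `Literature/AlgebraicGeometry/Motives`, namespace `Literature.AlgebraicGeometry.Motives`.  Theorems only: no definition, no
named fact, no instance, no notation, no `sorry`.  Universe `0`.

Setting ([MumfordFogartyKirwan1994] Ch. 0 §5 (c), the construction of `Hom_S(Y, X)` as an open subscheme of a closed subscheme of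
`Hilb(Y ×_S X / S)`): `q : Y → S`, `p : X → S`, an `S`-embedding `jW : Y ×_S X → 𝐏(ι; S)`; a Hilbert layer `h : HS → S` with its
embedded family `iH : Z_H ↪ 𝐏(ι; HS)` whose cohomology-and-base-change letters are a fixed polynomial `Q` at every field point (SELF);
a closed layer `cV : V' ↪ HS` over which the family `iV : Z_V ↪ 𝐏(ι; V')` (`Z_V = 𝐏(cV)^* Z_H`, square `HZ`) lies inside
`W := Y ×_S X` (`wZ : Z_V → W`, `wZ ≫ jW = iV ≫ 𝐏(cV ≫ h)`), with projection `g : Z_V → Y_{V'}`; and an open `U ⊆ V'` whose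
functor of points is «the base change of `g` is an isomorphism» (the open layer).  All of this is the OUTPUT of ★-in-HOME
`Motives/HomSchemePieceLocus` and is taken here as hypotheses, so that this file has ★-only imports.

* **`exists_homSchemePieceData`** — THE PIECE: `M := U` with the monomorphism `c := (U ↪ V') ≫ cV : M → HS`, `m := c ≫ h`
  (locally Noetherian source, separated, locally of finite type), the `M`-morphism `u : Y_M → X_M` («invert `g` over `U`, then
  project to `X`»), a GRAPH FAMILY `iΓ : Y_M ↪ 𝐏(ι; M)` of `u` (`iΓ ≫ pr_M = pr_M`, `iΓ ≫ 𝐏(m) = (pr_Y, u ≫ pr_X) ≫ jW`), and, for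
  EVERY graph family of `u` (it is unique): SELF — its letters are `Q` at every field point of `M` — and GRAPH-ID — it is the
  pull-back of the universal family `Z_H` along `𝐏(c)`.  These are the conjuncts «SELF ∧ GRAPH-ID» of sub-letter (B4a)
  `stub_IIb4B4a_pieceData` of the Hom-scheme skeleton `F4IIbHomScheme` (II-b (b4)), with `c := cM ≫ cV`; the remaining conjunct
  (UNIV-existence) is typed against the same exports.

Cell hodgecm-mathlib, F-4 (II-b) Hom-scheme assembly (b4), B-p14 (g20).  Count-neutral capital: HC_CM is proved only modulo the
7 printed citations until rung 0 closes; nothing here bears on it.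

## References

* D. Mumford, J. Fogarty, F. Kirwan, *Geometric Invariant Theory* (3rd ed., Springer, 1994), Ch. 0 §5 (c) (p. 23). [MumfordFogartyKirwan1994]
* U. Görtz, T. Wedhorn, *Algebraic Geometry I* (2nd ed., 2020), Section (4.12) and Def. 9.7. [GortzWedhorn2020]
* The Stacks Project, Tag 01NF (functoriality of `Proj` ∕ base change of projective space). [StacksProject]
-/

noncomputable section

set_option backward.isDefEq.respectTransparency false

open CategoryTheory CategoryTheory.Limits CategoryTheory.Abelian AlgebraicGeometry Polynomial
open Literature.Algebra.Homology Literature.Algebra.Homology.LaurentCech Literature.Algebra.Homology.OrderedCech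
open Literature.AlgebraicGeometry.Modules Literature.AlgebraicGeometry.Modules.SerreTwist

namespace Literature.AlgebraicGeometry.Motives

/-- `Ext`-vanishing transports along an isomorphism of the second argument. [folklore] -/
private theorem subsingleton_ext_of_iso₆ {C : Type*} [Category C] [Abelian C] [HasExt.{1} C] (P : C) {Y Y' : C}
    (e : Y ≅ Y') (i : ℕ) (h : Subsingleton (Ext.{1} P Y' i)) : Subsingleton (Ext.{1} P Y i) := by
  refine subsingleton_of_forall_eq 0 fun x => ?_
  have hx : x = (x.comp (Ext.mk₀ e.hom) (add_zero i)).comp (Ext.mk₀ e.inv) (add_zero i) := by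
    rw [Ext.comp_assoc_of_second_deg_zero, Ext.mk₀_comp_mk₀, e.hom_inv_id, Ext.comp_mk₀_id]
  rw [hx, Subsingleton.elim (x.comp (Ext.mk₀ e.hom) (add_zero i)) 0, Ext.zero_comp]

/-- `𝐏(ι; -)` is functorial (without `[Finite ι]`): `𝐏(a ≫ b) = 𝐏(a) ≫ 𝐏(b)`. [cite: StacksProject, Tag 01NF] -/
private theorem projectiveSpaceMap_comp₄ (ι : Type) {S T T' : Scheme.{0}} (a : T' ⟶ T) (b : T ⟶ S) :
    Morphisms.projectiveSpaceMap ι (a ≫ b) = Morphisms.projectiveSpaceMap ι a ≫ Morphisms.projectiveSpaceMap ι b := by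
  apply pullback.hom_ext
  · rw [Morphisms.projectiveSpaceMap_fst, Category.assoc, Morphisms.projectiveSpaceMap_fst,
      Morphisms.projectiveSpaceMap_fst_assoc]
  · rw [Morphisms.projectiveSpaceMap_snd, Category.assoc, Morphisms.projectiveSpaceMap_snd, Morphisms.projectiveSpaceMap_snd]

/-- A field point of a base change of an embedded family reads the fibre of the family and the same module (★
`isPullback_projectiveSpaceMap` pasted, ★ `SerreTwist.exists_pullback_twistMod_unitModule_iso`). [cite: StacksProject, Tag 01NF] -/
private theorem fieldPoint_of_baseChange₂ {ι : Type} {T Z T' Z' : Scheme.{0}} (i : Z ⟶ Morphisms.projectiveSpace ι T)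
    (v : T' ⟶ T) (g : Z' ⟶ Z) (i' : Z' ⟶ Morphisms.projectiveSpace ι T') (Hg : IsPullback g i' i (Morphisms.projectiveSpaceMap ι v))
    {K : Type} [Field K] {X₀ : Scheme.{0}} (k' : X₀ ⟶ Z') (f₀ : X₀ ⟶ Spec (CommRingCat.of K))
    (x' : Spec (CommRingCat.of K) ⟶ T') (H' : IsPullback k' f₀ (i' ≫ Morphisms.projectiveSpaceFst ι T') x') :
    IsPullback (k' ≫ g) f₀ (i ≫ Morphisms.projectiveSpaceFst ι T) (x' ≫ v) ∧
      ∀ e : ℕ, Nonempty ((Scheme.Modules.pullback (k' ≫ g)).obj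
          (twistMod (i ≫ pullback.snd (terminal.from T) (terminal.from (Morphisms.projectiveSpaceInt ι))) (unitModule Z) e) ≅
        (Scheme.Modules.pullback k').obj
          (twistMod (i' ≫ pullback.snd (terminal.from T') (terminal.from (Morphisms.projectiveSpaceInt ι))) (unitModule Z') e)) := by
  have HZ : IsPullback g (i' ≫ Morphisms.projectiveSpaceFst ι T') (i ≫ Morphisms.projectiveSpaceFst ι T) v :=
    Hg.paste_vert (Morphisms.isPullback_projectiveSpaceMap ι v)
  refine ⟨H'.paste_horiz HZ, fun e => ?_⟩
  have hsnd : i' ≫ pullback.snd (terminal.from T') (terminal.from (Morphisms.projectiveSpaceInt ι)) =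
      g ≫ (i ≫ pullback.snd (terminal.from T) (terminal.from (Morphisms.projectiveSpaceInt ι))) := by
    rw [← Morphisms.projectiveSpaceMap_snd ι v, ← Category.assoc, ← Hg.w, Category.assoc]
  obtain ⟨φ, -⟩ := exists_pullback_twistMod_unitModule_iso g
    (i ≫ pullback.snd (terminal.from T) (terminal.from (Morphisms.projectiveSpaceInt ι))) e
  have hobj : twistMod (i' ≫ pullback.snd (terminal.from T') (terminal.from (Morphisms.projectiveSpaceInt ι))) (unitModule Z') e =
      twistMod (g ≫ (i ≫ pullback.snd (terminal.from T) (terminal.from (Morphisms.projectiveSpaceInt ι)))) (unitModule Z') e :=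
    congrArg (fun f => twistMod f (unitModule Z') e) hsnd
  exact ⟨((Scheme.Modules.pullbackComp k' g).app _).symm ≪≫ (Scheme.Modules.pullback k').mapIso (φ ≪≫ eqToIso hobj.symm)⟩

/-- **THE PIECE OF THE HOM SCHEME WITH HILBERT POLYNOMIAL `Q`: data, SELF, GRAPH-ID** ([MumfordFogartyKirwan1994] Ch. 0 §5 (c):
`Hom_S(Y, X)` is the open subscheme «the projection to `Y` is an isomorphism» of the closed subscheme «the subscheme lies in
`Y ×_S X`» of the Hilbert scheme).  From the outputs of ★ `exists_homSchemePieceLocus` (closed layer `cV : V' ↪ HS` with its family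
`iV`, `wZ`, `g`, open layer `U ⊆ V'` with its functor of points `hU`) and the SELF letters of the universal family `iH`:
the piece `M := U`, `cM : M ↪ V'` the open immersion with image `U`, the monomorphism `c := cM ≫ cV`, the `M`-morphism
`u : Y_M → X_M` (`g` is invertible over `U` by `hU`; `u := g_U⁻¹ ≫ wZ ≫ pr_X`), a graph family `iΓ` of `u`, and for every graph family
of `u`: its letters are `Q` at every field point (SELF, transported from `iH` along the cartesian square over `𝐏(c)`) and it is
`𝐏(c)^* Z_H` (GRAPH-ID: `Z_V ×_{V'} U ↪ 𝐏(ι; U)` is cartesian over `𝐏(U ↪ V')` (★ `isPullback_projectiveSpaceMap`, `IsPullback.of_bot`),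
pasted with `HZ`). [cite: MumfordFogartyKirwan1994, Ch. 0 §5 (c) (p. 23)] [cite: GortzWedhorn2020, Section (4.12) and Def. 9.7] -/
theorem exists_homSchemePieceData {S Y X : Scheme.{0}} (q : Y ⟶ S) (p : X ⟶ S) {ι : Type}
    (jW : pullback q p ⟶ Morphisms.projectiveSpace ι S)
    -- the Hilbert layer, as data, with its SELF letters
    {HS : Scheme.{0}} [IsLocallyNoetherian HS] (h : HS ⟶ S) [IsSeparated h] [LocallyOfFiniteType h]
    {ZH : Scheme.{0}} (iH : ZH ⟶ Morphisms.projectiveSpace ι HS) (Q : ℚ[X])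
    (hself : ∀ ⦃K : Type⦄ [Field K] ⦃X₀ : Scheme.{0}⦄ (k : X₀ ⟶ ZH) (f₀ : X₀ ⟶ Spec (CommRingCat.of K))
      (x : Spec (CommRingCat.of K) ⟶ HS), IsPullback k f₀ (iH ≫ Morphisms.projectiveSpaceFst ι HS) x →
      ∀ e : ℕ, regularityBound (preHilbertPoly ℚ (Nat.card ι) 0) 0 (preHilbertPoly ℚ (Nat.card ι) 0 - Q) - 1 ≤ (e : ℤ) →
        Subsingleton (CategoryTheory.Abelian.Ext.{1} (unitModule X₀) ((Scheme.Modules.pullback k).obj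
              (twistMod (iH ≫ pullback.snd (terminal.from HS) (terminal.from (Morphisms.projectiveSpaceInt ι))) (unitModule _) e)) 1) ∧
              ((Module.finrank Γ(Spec (CommRingCat.of K), ⊤) (SecMod ((Scheme.Modules.pullback k).obj
                (twistMod (iH ≫ pullback.snd (terminal.from HS) (terminal.from (Morphisms.projectiveSpaceInt ι))) (unitModule _) e))
                f₀.appTop.hom ⊤) : ℕ) : ℚ) = Q.eval (e : ℚ))
    -- the closed layer, as data (★ `exists_homSchemePieceLocus`)
    {V' : Scheme.{0}} (cV : V' ⟶ HS) [IsClosedImmersion cV] [IsLocallyNoetherian V']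
    {ZV : Scheme.{0}} (iV : ZV ⟶ Morphisms.projectiveSpace ι V') (gZ : ZV ⟶ ZH)
    (HZ : IsPullback iV gZ (Morphisms.projectiveSpaceMap ι cV) iH)
    (wZ : ZV ⟶ pullback q p) (hwZ : wZ ≫ jW = iV ≫ Morphisms.projectiveSpaceMap ι (cV ≫ h))
    (g : ZV ⟶ pullback q (cV ≫ h)) (hg₁ : g ≫ pullback.fst q (cV ≫ h) = wZ ≫ pullback.fst q p)
    (hg₂ : g ≫ pullback.snd q (cV ≫ h) = iV ≫ Morphisms.projectiveSpaceFst ι V')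
    -- the open layer (★ `exists_homSchemePieceLocus`)
    (U : V'.Opens)
    (hU : ∀ ⦃T : Scheme.{0}⦄ (b : T ⟶ V'),
      IsIso (pullback.map (iV ≫ Morphisms.projectiveSpaceFst ι V') b (pullback.snd q (cV ≫ h)) b g (𝟙 T) (𝟙 V')
        (by rw [Category.comp_id, hg₂]) (by rw [Category.comp_id, Category.id_comp])) ↔
        Set.range b.base ⊆ (U : Set V')) :
    ∃ (M : Scheme.{0}) (cM : M ⟶ V') (_ : IsOpenImmersion cM) (_ : Set.range cM.base = (U : Set V'))
      (_ : Mono (cM ≫ cV)) (_ : IsLocallyNoetherian M) (_ : IsSeparated ((cM ≫ cV) ≫ h))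
      (_ : LocallyOfFiniteType ((cM ≫ cV) ≫ h))
      (u : pullback q ((cM ≫ cV) ≫ h) ⟶ pullback p ((cM ≫ cV) ≫ h))
      (_ : u ≫ pullback.snd p ((cM ≫ cV) ≫ h) = pullback.snd q ((cM ≫ cV) ≫ h)),
      -- a graph family of `u` exists
      (∃ iΓ : pullback q ((cM ≫ cV) ≫ h) ⟶ Morphisms.projectiveSpace ι M,
        iΓ ≫ Morphisms.projectiveSpaceFst ι M = pullback.snd q ((cM ≫ cV) ≫ h) ∧
        ∀ hw : pullback.fst q ((cM ≫ cV) ≫ h) ≫ q = (u ≫ pullback.fst p ((cM ≫ cV) ≫ h)) ≫ p,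
          iΓ ≫ Morphisms.projectiveSpaceMap ι ((cM ≫ cV) ≫ h) =
            pullback.lift (pullback.fst q ((cM ≫ cV) ≫ h)) (u ≫ pullback.fst p ((cM ≫ cV) ≫ h)) hw ≫ jW) ∧
      -- SELF: every graph family of `u` has the letters `Q` at every field point of `M`
      (∀ (hw : pullback.fst q ((cM ≫ cV) ≫ h) ≫ q = (u ≫ pullback.fst p ((cM ≫ cV) ≫ h)) ≫ p)
        (iΓ : pullback q ((cM ≫ cV) ≫ h) ⟶ Morphisms.projectiveSpace ι M),
        iΓ ≫ Morphisms.projectiveSpaceFst ι M = pullback.snd q ((cM ≫ cV) ≫ h) →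
        iΓ ≫ Morphisms.projectiveSpaceMap ι ((cM ≫ cV) ≫ h) =
          pullback.lift (pullback.fst q ((cM ≫ cV) ≫ h)) (u ≫ pullback.fst p ((cM ≫ cV) ≫ h)) hw ≫ jW →
        ∀ ⦃K : Type⦄ [Field K] ⦃X₀ : Scheme.{0}⦄ (k : X₀ ⟶ pullback q ((cM ≫ cV) ≫ h)) (f₀ : X₀ ⟶ Spec (CommRingCat.of K))
          (x : Spec (CommRingCat.of K) ⟶ M), IsPullback k f₀ (iΓ ≫ Morphisms.projectiveSpaceFst ι M) x →
          ∀ e : ℕ, regularityBound (preHilbertPoly ℚ (Nat.card ι) 0) 0 (preHilbertPoly ℚ (Nat.card ι) 0 - Q) - 1 ≤ (e : ℤ) →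
            Subsingleton (CategoryTheory.Abelian.Ext.{1} (unitModule X₀) ((Scheme.Modules.pullback k).obj
              (twistMod (iΓ ≫ pullback.snd (terminal.from M) (terminal.from (Morphisms.projectiveSpaceInt ι))) (unitModule _) e)) 1) ∧
              ((Module.finrank Γ(Spec (CommRingCat.of K), ⊤) (SecMod ((Scheme.Modules.pullback k).obj
                (twistMod (iΓ ≫ pullback.snd (terminal.from M) (terminal.from (Morphisms.projectiveSpaceInt ι))) (unitModule _) e))
                f₀.appTop.hom ⊤) : ℕ) : ℚ) = Q.eval (e : ℚ)) ∧
      -- GRAPH-ID: every graph family of `u` is the universal family pulled back along `𝐏(c)`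
      ∀ (hw : pullback.fst q ((cM ≫ cV) ≫ h) ≫ q = (u ≫ pullback.fst p ((cM ≫ cV) ≫ h)) ≫ p)
        (iΓ : pullback q ((cM ≫ cV) ≫ h) ⟶ Morphisms.projectiveSpace ι M),
        iΓ ≫ Morphisms.projectiveSpaceFst ι M = pullback.snd q ((cM ≫ cV) ≫ h) →
        iΓ ≫ Morphisms.projectiveSpaceMap ι ((cM ≫ cV) ≫ h) =
          pullback.lift (pullback.fst q ((cM ≫ cV) ≫ h)) (u ≫ pullback.fst p ((cM ≫ cV) ≫ h)) hw ≫ jW →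
        ∃ e : pullback q ((cM ≫ cV) ≫ h) ⟶ ZH, IsPullback e iΓ iH (Morphisms.projectiveSpaceMap ι (cM ≫ cV)) := by
  -- THE PIECE `M := U`, `cM := U ↪ V'`
  let M : Scheme.{0} := U
  let cM : M ⟶ V' := U.ι
  have hrange : Set.range cM.base = (U : Set V') := U.range_ι
  haveI : Mono (cM ≫ cV) := mono_comp _ _
  -- the family over `M` and its projection `gU` to `Y_{V'} ×_{V'} M`, an isomorphism by the open layer
  let f : ZV ⟶ V' := iV ≫ Morphisms.projectiveSpaceFst ι V'
  let gU : pullback f cM ⟶ pullback (pullback.snd q (cV ≫ h)) cM :=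
    pullback.map f cM (pullback.snd q (cV ≫ h)) cM g (𝟙 M) (𝟙 V') (by rw [Category.comp_id, hg₂])
      (by rw [Category.comp_id, Category.id_comp])
  haveI : IsIso gU := (hU cM).2 hrange.le
  -- `Y_{V'} ×_{V'} M = Y_M`
  have H2 : IsPullback (pullback.fst (pullback.snd q (cV ≫ h)) cM ≫ pullback.fst q (cV ≫ h))
      (pullback.snd (pullback.snd q (cV ≫ h)) cM) q ((cM ≫ cV) ≫ h) := by
    simpa only [Category.assoc] using
      (IsPullback.of_hasPullback (pullback.snd q (cV ≫ h)) cM).paste_horiz (IsPullback.of_hasPullback q (cV ≫ h))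
  let eY : pullback f cM ⟶ pullback q ((cM ≫ cV) ≫ h) := gU ≫ H2.isoPullback.hom
  let θ : pullback q ((cM ≫ cV) ≫ h) ⟶ pullback f cM := inv eY
  have hθsnd : θ ≫ pullback.snd f cM = pullback.snd q ((cM ≫ cV) ≫ h) := by
    rw [IsIso.inv_comp_eq]
    change _ = (gU ≫ H2.isoPullback.hom) ≫ _
    rw [Category.assoc, IsPullback.isoPullback_hom_snd, pullback.lift_snd, Category.comp_id]
  have hθg : θ ≫ pullback.fst f cM ≫ g = H2.isoPullback.inv ≫ pullback.fst (pullback.snd q (cV ≫ h)) cM := by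
    rw [IsIso.inv_comp_eq]
    change _ = (gU ≫ H2.isoPullback.hom) ≫ _
    rw [Category.assoc, Iso.hom_inv_id_assoc, pullback.lift_fst]
  have hθ₁ : θ ≫ pullback.fst f cM ≫ g ≫ pullback.fst q (cV ≫ h) = pullback.fst q ((cM ≫ cV) ≫ h) := by
    rw [reassoc_of% hθg, IsPullback.isoPullback_inv_fst]
  have hθ₂ : θ ≫ pullback.fst f cM ≫ g ≫ pullback.snd q (cV ≫ h) = pullback.snd q ((cM ≫ cV) ≫ h) ≫ cM := by
    rw [reassoc_of% hθg, pullback.condition, IsPullback.isoPullback_inv_snd_assoc]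
  -- the morphism `u : Y_M → X_M`
  have huw : (θ ≫ pullback.fst f cM ≫ wZ ≫ pullback.snd q p) ≫ p =
      pullback.snd q ((cM ≫ cV) ≫ h) ≫ (cM ≫ cV) ≫ h := by
    simp only [Category.assoc]
    rw [← pullback.condition (f := q) (g := p), ← reassoc_of% hg₁, pullback.condition (f := q) (g := cV ≫ h),
      reassoc_of% hθ₂]
  let u : pullback q ((cM ≫ cV) ≫ h) ⟶ pullback p ((cM ≫ cV) ≫ h) :=
    pullback.lift (θ ≫ pullback.fst f cM ≫ wZ ≫ pullback.snd q p) (pullback.snd q ((cM ≫ cV) ≫ h)) huw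
  have hu : u ≫ pullback.snd p ((cM ≫ cV) ≫ h) = pullback.snd q ((cM ≫ cV) ≫ h) := pullback.lift_snd _ _ _
  have hu₁ : u ≫ pullback.fst p ((cM ≫ cV) ≫ h) = θ ≫ pullback.fst f cM ≫ wZ ≫ pullback.snd q p := pullback.lift_fst _ _ _
  -- the graph family `iΓM := θ ≫ i'`, `i' : Z_V ×_{V'} M ↪ 𝐏(ι; M)`
  have HP := Morphisms.isPullback_projectiveSpaceMap ι cM
  have hcond : (pullback.fst f cM ≫ iV) ≫ Morphisms.projectiveSpaceFst ι V' = pullback.snd f cM ≫ cM := by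
    rw [Category.assoc]; exact pullback.condition
  let i' : pullback f cM ⟶ Morphisms.projectiveSpace ι M := HP.lift (pullback.fst f cM ≫ iV) (pullback.snd f cM) hcond
  have hi'₁ : i' ≫ Morphisms.projectiveSpaceMap ι cM = pullback.fst f cM ≫ iV := HP.lift_fst _ _ hcond
  have hi'₂ : i' ≫ Morphisms.projectiveSpaceFst ι M = pullback.snd f cM := HP.lift_snd _ _ hcond
  have Hsq1 : IsPullback (pullback.fst f cM) i' iV (Morphisms.projectiveSpaceMap ι cM) := by
    refine IsPullback.of_bot ?_ hi'₁.symm HP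
    rw [hi'₂]
    exact IsPullback.of_hasPullback f cM
  let iΓM : pullback q ((cM ≫ cV) ≫ h) ⟶ Morphisms.projectiveSpace ι M := θ ≫ i'
  have heq₁ : iΓM ≫ Morphisms.projectiveSpaceFst ι M = pullback.snd q ((cM ≫ cV) ≫ h) := by
    change (θ ≫ i') ≫ _ = _
    rw [Category.assoc θ i', hi'₂, hθsnd]
  have heq₂ : ∀ hw : pullback.fst q ((cM ≫ cV) ≫ h) ≫ q = (u ≫ pullback.fst p ((cM ≫ cV) ≫ h)) ≫ p,
      iΓM ≫ Morphisms.projectiveSpaceMap ι ((cM ≫ cV) ≫ h) =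
        pullback.lift (pullback.fst q ((cM ≫ cV) ≫ h)) (u ≫ pullback.fst p ((cM ≫ cV) ≫ h)) hw ≫ jW := by
    intro hw
    have hlift : pullback.lift (pullback.fst q ((cM ≫ cV) ≫ h)) (u ≫ pullback.fst p ((cM ≫ cV) ≫ h)) hw =
        θ ≫ pullback.fst f cM ≫ wZ := by
      apply pullback.hom_ext
      · rw [pullback.lift_fst, Category.assoc θ, Category.assoc (pullback.fst f cM), ← hg₁, hθ₁]
      · rw [pullback.lift_snd, Category.assoc θ, Category.assoc (pullback.fst f cM), hu₁]
    have hPm : Morphisms.projectiveSpaceMap ι ((cM ≫ cV) ≫ h) =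
        Morphisms.projectiveSpaceMap ι cM ≫ Morphisms.projectiveSpaceMap ι (cV ≫ h) := by
      rw [Category.assoc, projectiveSpaceMap_comp₄]
    change (θ ≫ i') ≫ _ = _
    rw [hlift, hPm, Category.assoc θ i', reassoc_of% hi'₁, ← hwZ, Category.assoc θ (pullback.fst f cM ≫ wZ) jW,
      Category.assoc (pullback.fst f cM) wZ jW]
  -- GRAPH-ID for `iΓM`
  have HΓ : IsPullback (θ ≫ pullback.fst f cM ≫ gZ) iΓM iH (Morphisms.projectiveSpaceMap ι (cM ≫ cV)) := by
    have Hθ : IsPullback θ (θ ≫ i') i' (𝟙 _) := IsPullback.of_horiz_isIso ⟨(Category.comp_id _).symm⟩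
    have H := Hθ.paste_horiz (Hsq1.paste_horiz HZ.flip)
    rw [Category.id_comp, ← projectiveSpaceMap_comp₄] at H
    simpa only [Category.assoc] using H
  -- every graph family of `u` is `iΓM`
  have huniq : ∀ (hw : pullback.fst q ((cM ≫ cV) ≫ h) ≫ q = (u ≫ pullback.fst p ((cM ≫ cV) ≫ h)) ≫ p)
      (iΓ : pullback q ((cM ≫ cV) ≫ h) ⟶ Morphisms.projectiveSpace ι M),
      iΓ ≫ Morphisms.projectiveSpaceFst ι M = pullback.snd q ((cM ≫ cV) ≫ h) →
      iΓ ≫ Morphisms.projectiveSpaceMap ι ((cM ≫ cV) ≫ h) =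
        pullback.lift (pullback.fst q ((cM ≫ cV) ≫ h)) (u ≫ pullback.fst p ((cM ≫ cV) ≫ h)) hw ≫ jW → iΓ = iΓM :=
    fun hw iΓ h₁ h₂ => (Morphisms.isPullback_projectiveSpaceMap ι ((cM ≫ cV) ≫ h)).hom_ext (h₂.trans (heq₂ hw).symm)
      (h₁.trans heq₁.symm)
  refine ⟨M, cM, inferInstance, hrange, inferInstance, inferInstance, inferInstance, inferInstance, u, hu,
    ⟨iΓM, heq₁, heq₂⟩, ?_, ?_⟩
  · -- SELF, transported from `iH` along the square `HΓ`
    intro hw iΓ h₁ h₂ K _ X₀ k f₀ x H' e he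
    obtain rfl := huniq hw iΓ h₁ h₂
    obtain ⟨Hx, hψ⟩ := fieldPoint_of_baseChange₂ iH (cM ≫ cV) (θ ≫ pullback.fst f cM ≫ gZ) iΓM HΓ k f₀ x H'
    obtain ⟨hvan, hrk⟩ := hself (k ≫ θ ≫ pullback.fst f cM ≫ gZ) f₀ (x ≫ cM ≫ cV) Hx e he
    refine ⟨subsingleton_ext_of_iso₆ (unitModule X₀) (hψ e).some.symm 1 hvan, ?_⟩
    obtain ⟨L, -⟩ := Morphisms.exists_secMod_linearEquiv_of_iso f₀.appTop.hom (hψ e).some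
    rw [← L.finrank_eq, hrk]
  · -- GRAPH-ID
    intro hw iΓ h₁ h₂
    obtain rfl := huniq hw iΓ h₁ h₂
    exact ⟨θ ≫ pullback.fst f cM ≫ gZ, HΓ⟩

end Literature.AlgebraicGeometry.Motives

end
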